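import Literature.Topology.FourManifolds.SphereSurgeryOddMiddleHomology
import Literature.Topology.FourManifolds.SphereCoreMeridian
import Literature.Topology.FourManifolds.SphereCorePrimitive
import Literature.GroupTheory.FiniteAbelian.QuotientCyclicRank
import HarnessLib

/-!
# Surgery in the middle dimension of an odd-dimensional manifold, II: the `k`-th Betti number
# before and after (Kervaire–Milnor's Lemma 5.8 reduced to the isotropy of the torus)

Topic `Literature/Topology/FourManifolds`; sequel of `SphereSurgeryOddMiddleHomology.lean`
(Kervaire–Milnor's Lemma 5.6 and the Assertion of p. 516), `SphereCoreMeridian.lean` (the exact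
kernel `ker (HₖM₀ → HₖM) = ε'(Z)`) and `SphereCorePrimitive.lean` (the duality sentence of
Lemma 5.7), written for the fact seat of
`Literature.Topology.FourManifolds.HomotopySphere.boundsContractible_of_nullCobordism_isStablyParallelizable_four`
(M. Kervaire, J. Milnor, *Groups of homotopy spheres I*, Ann. of Math. (2) 77 (1963), Thm. 5.1 at
`k = 2`), whose reduction along the printed proof
(`HomotopySphere.boundsContractible_of_nullCobordism_isStablyParallelizable_four_of_surgeryLemmas_homological`,
`ThetaFourKervaireMilnorHomologyStep.lean`) has **Lemma 5.8** as one of its three remaining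
hypotheses (`h58`): *"If `k` is even then the modification `χ(φ)` necessarily changes the `k`-th
Betti number of `M`"* (p. 516). Everything here is **proved**; no definition and no named fact is
introduced (D-0026).

Kervaire–Milnor prove Lemma 5.8 (pp. 517–518) through Lemma 5.9, the semi-characteristic of the
boundary of the `(2k+2)`-dimensional trace of the modification. Here the Betti numbers are read
off the two exact sequences of Lemma 5.6 instead: with `G = Hₖ(X ∖ S)`, `ε`, `ε'` the classes of
the parallel and the meridian spheres, `HₖX ≅ G/ε'(Z)` (`SphereCoreMeridian`) and
`HₖP ≅ G/ε(Z)` (the handle side, proved here), so that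

  `rank HₖX = rank G - [ε' of infinite order]`, `rank HₖP = rank G - [ε of infinite order]`,

and **Lemma 5.8 is equivalent to: exactly one of `ε`, `ε'` is a torsion element of `G`**. The
duality of Lemma 5.7 (`SphereCorePrimitive`, both directions: `μ·λ` runs over the values `f(λ)`
of the functionals `f` on `HₖM`) settles everything except the "diagonal" case `mε = nε' ≠ 0`,
which is excluded exactly by the **isotropy of the torus**: the kernel of
`Hₖ(φ(Sᵏ × Sᵏ)) → Hₖ(M₀)` is isotropic for the intersection form of `Sᵏ × Sᵏ`, which for `k`
EVEN is the hyperbolic symmetric plane on `ε`, `ε'`, whose isotropic vectors lie on the axes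
(Thom 1952, Thm. V.7/V.10: for the compact `M₀ = M ∖ int φ(Sᵏ × Dᵏ⁺¹)` with
`bM₀ = bM + φ(Sᵏ × Sᵏ)`, "half lives, half dies" isotropically). That isotropy — the only
parity-sensitive input — is taken here as the hypothesis

  `(ISO)  ∀ m n : ℤ, m • ε = n • ε' in Hₖ(X ∖ S; ℤ) → m * n = 0`,

and this file PROVES Lemma 5.8 from it:

* `finrank_quotient_zmultiples_eq_iff` — `rank (N/x(Z)) = rank (N/y(Z))` iff `x`, `y` are both of
  finite or both of infinite order, for a finitely generated abelian group (from the rank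
  book-keeping of `Literature/GroupTheory/FiniteAbelian/QuotientCyclicRank.lean`);
* `FramedSphereFamily.surjective_map_jA_and_ker_eq` — **the vertical sequence of Lemma 5.6**
  (p. 515–516): `(jA)_* : Hₖ(X ∖ S) → Hₖ(P)` is onto with kernel EXACTLY `ε(Z)`, the class of the
  parallel (Mayer–Vietoris for `P = jA(X ∖ S) ∪ jB(ODᵏ⁺¹ × Sᵏ)`; in the handle the parallel dies
  and the meridian is a generator of infinite order, `PuncturedTubeMiddleHomology`; the chase
  `surjective_and_ker_eq_zmultiples_of_mayerVietoris`);
* `FramedSphereFamily.ofAbsolute_complement_eq_zero_of_forall_dual_eq_zero` — **the converse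
  duality sentence**: if every functional `f : HₖW → ℤ` kills `λ` (i.e. `λ` is a torsion class),
  then `Hₗ₊₁(W) → Hₗ₊₁(W, W ∖ S)` vanishes ("`μ·λ = ⟨α, λ⟩ = 0`", same Čech–Lefschetz computation
  as `SphereCorePrimitive.exists_ofAbsolute_eq_zsmul_of_exists_dual`);
  `FramedSphereFamily.exists_not_isOfFinAddOrder_relativeHomology_complement` —
  `Hₗ₊₁(W, W ∖ S; ℤ)` has a class of infinite order (Čech duality along the core: it is
  `≅ Ȟᵏ(S) ≅ Hᵏ(Sᵏ) ≅ ℤ`);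
* `FramedSphereFamily.xor_isOfFinAddOrder_of_iso` — exactly one of `ε`, `ε'` is torsion, from
  `(ISO)`, for a framed `k`-sphere (fibre `ℝᵏ⁺¹`, `k ≥ 2`) in a compact simply connected
  `(2k+1)`-manifold `W` with `Hₖ(∂W) = 0`;
* `FramedSphereFamily.finrank_ne_finrank_surgered_of_iso`,
  `NullCobordism.finrank_ne_finrank_surgery_of_iso` — **Lemma 5.8 from (ISO)**:
  `rank Hₖ(χ(W, φ); ℤ) ≠ rank Hₖ(W; ℤ)`.

## References

* M. Kervaire, J. Milnor, *Groups of homotopy spheres I*, Ann. of Math. (2) 77 (1963), 504–537: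
  Lemma 5.6 (pp. 514–516), Lemma 5.7 and its proof (p. 516), Lemma 5.8 (pp. 516–518).
  doi:10.2307/1970128 [KervaireMilnorAnnals1963]
* R. Thom, *Espaces fibrés en sphères et carrés de Steenrod*, Ann. Sci. ENS 69 (1952), Thm. V.7,
  Cor. V.8, Thm. V.10 (pp. 173–176). [Thom1952]
* A. Hatcher, *Algebraic Topology*, CUP 2002, §2.2 (Mayer–Vietoris), §3.1 Thm. 3.2, §3.3
  Thm. 3.43. [HatcherAT2002]
-/

noncomputable section

open scoped Manifold ContDiff Topology ContinuousMap
open CategoryTheory Limits Set Function Metric Topology AddSubgroup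
open Literature.AlgebraicTopology.SingularHomology

namespace Literature.Topology.FourManifolds

/-! ### Rank of the quotient by one cyclic subgroup -/

section Rank

variable {N : Type*} [AddCommGroup N]

/-- `rank (N/x(Z)) = rank (N/y(Z))` iff `x` and `y` are both of finite order or both of infinite
order (finitely generated abelian `N`; Kervaire–Milnor 1963, p. 519, the ranks of `HₖM/λ(Z)`).
[cite: KervaireMilnorAnnals1963, Lemma 5.8 (p. 516) and p. 519] -/
theorem finrank_quotient_zmultiples_eq_iff [AddGroup.FG N] (x y : N) :
    Module.finrank ℤ (N ⧸ zmultiples x) = Module.finrank ℤ (N ⧸ zmultiples y) ↔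
      (IsOfFinAddOrder x ↔ IsOfFinAddOrder y) := by
  have hfin : ∀ {z : N}, IsOfFinAddOrder z →
      Module.finrank ℤ (N ⧸ zmultiples z) = Module.finrank ℤ N := fun hz =>
    Literature.GroupTheory.FiniteAbelian.finrank_quotient_zmultiples_of_isOfFinAddOrder hz
  have hinf : ∀ {z : N}, ¬IsOfFinAddOrder z →
      Module.finrank ℤ (N ⧸ zmultiples z) + 1 = Module.finrank ℤ N := fun hz =>
    Literature.GroupTheory.FiniteAbelian.finrank_quotient_zmultiples_add_one_of_not_isOfFinAddOrder hz
  by_cases h₁ : IsOfFinAddOrder x <;> by_cases h₂ : IsOfFinAddOrder y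
  · rw [hfin h₁, hfin h₂]
    exact ⟨fun _ => ⟨fun _ => h₂, fun _ => h₁⟩, fun _ => rfl⟩
  · have hx := hfin h₁
    have hy := hinf h₂
    constructor
    · intro h; omega
    · intro h; exact absurd (h.1 h₁) h₂
  · have hx := hinf h₁
    have hy := hfin h₂
    constructor
    · intro h; omega
    · intro h; exact absurd (h.2 h₂) h₁
  · have hx := hinf h₁
    have hy := hinf h₂
    constructor
    · intro _; exact ⟨fun h => absurd h h₁, fun h => absurd h h₂⟩
    · intro _; omega

end Rank

/-! ### The vertical sequence of Lemma 5.6: `Hₖ(X ∖ S) → Hₖ(P)` is onto with kernel `ε(Z)` -/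

namespace FramedSphereFamily

section HandleKernel

variable {EX HX : Type*} [NormedAddCommGroup EX] [NormedSpace ℝ EX] [TopologicalSpace HX]
  {IX : ModelWithCorners ℝ EX HX} {X : Type} [TopologicalSpace X] [ChartedSpace HX X] [T2Space X]
  {ι : Type} [Unique ι] {k : ℕ} {ν : FramedSphereFamily IX X ι k (k + 1)}
  {P : Type} [TopologicalSpace P]
  {jA : ↥ν.complement → P} {jB : ↥(ballTimesSphere ι k k) → P}
  (hA : IsOpenEmbedding jA) (hB : IsOpenEmbedding jB) (hcov : range jA ∪ range jB = univ)
  (hrel : ∀ a b, jA a = jB b ↔ sphereFamilySurgeryRel ν a b)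

include hA hB hcov hrel in
/-- **`(jA)_* : Hₖ(X ∖ S) → Hₖ(P)` is onto with kernel generated by the parallel class** (`k ≥ 2`,
`ι` a one-element index type). Kervaire–Milnor 1963, proof of Lemma 5.6 (pp. 515–516), the
vertical exact sequence `Hₖ₊₁(M', M₀) ≅ Z →ε→ HₖM₀ →i'→ HₖM' → 0`: "`ε = ε(1) ∈ HₖM₀` is the
homology class of the parallel `φ(Sᵏ × x₀)` of the torus". Here for the open model
`M₀ = X ∖ S` and the surgered space `P = jA(X ∖ S) ∪ jB(ODᵏ⁺¹ × Sᵏ)`, by Mayer–Vietoris: the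
pieces meet in the punctured tube, whose `Hₖ` is generated by the meridian and the parallel and
whose `Hₖ₋₁` vanishes; in the handle `≃ Sᵏ` the parallel dies and the meridian is a generator of
infinite order (`PuncturedTubeMiddleHomology`); the diagram chase is
`surjective_and_ker_eq_zmultiples_of_mayerVietoris`. Stated for a generator `θ` of `Hₖ(Sᵏ; ℤ)`,
the parallel class being `(parallelSphere hv₀)_* θ`.
[cite: KervaireMilnorAnnals1963, Lemma 5.6, proof (pp. 515–516), vertical sequence] -/
theorem surjective_map_jA_and_ker_eq (hk : 2 ≤ k)
    {θ : singularHomology ℤ ℤ (Metric.sphere (0 : EuclideanSpace ℝ (Fin (k + 1))) 1) k}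
    (hθ : zmultiples θ = ⊤) {v₀ : EuclideanSpace ℝ (Fin (k + 1))} (hv₀ : v₀ ≠ 0) (hv₁ : ‖v₀‖ < 1) :
    Function.Surjective (singularHomology.map ℤ ℤ (⟨jA, hA.continuous⟩ : C(_, P)) k) ∧
      (singularHomology.map ℤ ℤ (⟨jA, hA.continuous⟩ : C(_, P)) k).hom.toAddMonoidHom.ker =
        zmultiples (singularHomology.map ℤ ℤ (ν.parallelSphere hv₀) k θ) := by
  obtain ⟨j, rfl⟩ : ∃ j, k = j + 1 := ⟨k - 1, by omega⟩
  -- the cover, its pieces and their models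
  set U : Set P := range jA with hU
  set T : Set P := range jB with hT
  have hint : interior U ∪ interior T = univ := by
    rw [hA.isOpen_range.interior_eq, hB.isOpen_range.interior_eq, hcov]
  have hexc := relativeSingularHomology.isIso_map_of_interior_union_interior_holds ℤ ℤ P
  let eA : ↥ν.complement ≃ₜ ↥U := hA.isEmbedding.toHomeomorph
  let eI : ↥(puncturedUnitTube (j + 1) (j + 1)) ≃ₜ ↥(U ∩ T) := tubeInterHomeomorph hA hrel
  let eT : ↥(ballTimesSphere ι (j + 1) (j + 1)) ≃ₜ ↥T := hB.isEmbedding.toHomeomorph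
  let eAc : C(↥ν.complement, ↥U) := eA
  let eIc : C(↥(puncturedUnitTube (j + 1) (j + 1)), ↥(U ∩ T)) := eI
  let eTc : C(↥(ballTimesSphere ι (j + 1) (j + 1)), ↥T) := eT
  let u₀ : Metric.sphere (0 : EuclideanSpace ℝ (Fin (j + 1 + 1))) 1 := spherePt (j + 1)
  -- the four maps of the Mayer–Vietoris sequence, as homomorphisms of abelian groups
  let a₁ := (singularHomology.map ℤ ℤ (subsetInclusion (inter_subset_left : U ∩ T ⊆ U)) (j + 1)).hom.toAddMonoidHom
  let a₂ := (singularHomology.map ℤ ℤ (subsetInclusion (inter_subset_right : U ∩ T ⊆ T)) (j + 1)).hom.toAddMonoidHom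
  let u := (singularHomology.map ℤ ℤ (subsetIncl U) (j + 1)).hom.toAddMonoidHom
  let w := (singularHomology.map ℤ ℤ (subsetIncl T) (j + 1)).hom.toAddMonoidHom
  -- the two classes of the intersection: the parallel `p` (which dies) and the meridian `m`
  let p := singularHomology.map ℤ ℤ (eIc.comp (parallelPT (k := j + 1) hv₀ hv₁)) (j + 1) θ
  let m := singularHomology.map ℤ ℤ (eIc.comp (meridianPT (k := j + 1) (l := j + 1) u₀)) (j + 1) θ
  -- (1) `u ∘ a₁ = w ∘ a₂`
  have hcomp : ∀ z, u (a₁ z) = w (a₂ z) := by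
    intro z
    change (singularHomology.map ℤ ℤ (subsetInclusion inter_subset_left) (j + 1) ≫
        singularHomology.map ℤ ℤ (subsetIncl U) (j + 1)) z =
      (singularHomology.map ℤ ℤ (subsetInclusion inter_subset_right) (j + 1) ≫
        singularHomology.map ℤ ℤ (subsetIncl T) (j + 1)) z
    rw [← singularHomology.map_comp, ← singularHomology.map_comp]
    rfl
  -- (2) `ψ` is onto: `H_j` of the intersection vanishes (`0 < j < k`)
  have hI0 : IsZero (singularHomology ℤ ℤ ↥(U ∩ T) j) := by
    rcases Nat.eq_zero_or_pos j with hj | hj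
    · omega
    · exact (isZero_singularHomology_puncturedTube ℤ ℤ (k := j + 1) (l := j + 1) hj.ne'
        (by omega) (by omega)).of_iso (singularHomology.mapIso ℤ ℤ eI.symm j)
  have hsurjψ : Function.Surjective (mayerVietoris.ψ ℤ ℤ U T (j + 1)) := by
    haveI : Epi (mayerVietoris.ψ ℤ ℤ U T (j + 1)) :=
      (mayerVietoris.exact₂_holds ℤ ℤ U T hexc hint j).epi_f (hI0.eq_of_tgt _ _)
    exact (ModuleCat.epi_iff_surjective _).1 inferInstance
  have hsurj : ∀ y, ∃ x v, u x + w v = y := by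
    intro y
    obtain ⟨b, hb⟩ := hsurjψ y
    refine ⟨(biprod.fst : _ ⊞ _ ⟶ singularHomology ℤ ℤ ↥U (j + 1)) b,
      (biprod.snd : _ ⊞ _ ⟶ singularHomology ℤ ℤ ↥T (j + 1)) b, ?_⟩
    rw [← hb, mayerVietoris.ψ, biprod_desc_apply]
    rfl
  -- (3) exactness at `H(U) ⊕ H(T)`
  have hexact : ∀ x v, u x + w v = 0 → ∃ z, a₁ z = x ∧ -a₂ z = v := by
    intro x v hxv
    let HU := singularHomology ℤ ℤ ↥U (j + 1)
    let HT := singularHomology ℤ ℤ ↥T (j + 1)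
    have hex := (ShortComplex.moduleCat_exact_iff _).1
      (mayerVietoris.exact₁_holds ℤ ℤ U T hint (j + 1))
    let x₂ : ↑(HU ⊞ HT) := (biprod.inl : HU ⟶ HU ⊞ HT) x + (biprod.inr : HT ⟶ HU ⊞ HT) v
    have hfst : (biprod.fst : HU ⊞ HT ⟶ HU) x₂ = x := by
      change (biprod.fst : HU ⊞ HT ⟶ HU)
        ((biprod.inl : HU ⟶ HU ⊞ HT) x + (biprod.inr : HT ⟶ HU ⊞ HT) v) = x
      rw [map_add, ← ModuleCat.comp_apply, ← ModuleCat.comp_apply, biprod.inl_fst, biprod.inr_fst]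
      simp
    have hsnd : (biprod.snd : HU ⊞ HT ⟶ HT) x₂ = v := by
      change (biprod.snd : HU ⊞ HT ⟶ HT)
        ((biprod.inl : HU ⟶ HU ⊞ HT) x + (biprod.inr : HT ⟶ HU ⊞ HT) v) = v
      rw [map_add, ← ModuleCat.comp_apply, ← ModuleCat.comp_apply, biprod.inl_snd, biprod.inr_snd]
      simp
    have hx₂ : mayerVietoris.ψ ℤ ℤ U T (j + 1) x₂ = 0 := by
      change mayerVietoris.ψ ℤ ℤ U T (j + 1)
        ((biprod.inl : HU ⟶ HU ⊞ HT) x + (biprod.inr : HT ⟶ HU ⊞ HT) v) = 0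
      rw [map_add, mayerVietoris.ψ, biprod_desc_inl_apply, biprod_desc_inr_apply]
      exact hxv
    obtain ⟨z, hz⟩ := hex x₂ hx₂
    change mayerVietoris.φ ℤ ℤ U T (j + 1) z = x₂ at hz
    refine ⟨z, ?_, ?_⟩
    · have h1 := congrArg (biprod.fst : HU ⊞ HT ⟶ HU) hz
      rw [mayerVietoris.φ, biprod_fst_lift_apply, hfst] at h1
      exact h1
    · have h2 := congrArg (biprod.snd : HU ⊞ HT ⟶ HT) hz
      rw [mayerVietoris.φ, biprod_snd_lift_apply, hsnd] at h2
      rw [← h2]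
      rfl
  -- (4) `H_k` of the intersection is generated by the parallel and the meridian
  have hgen : ∀ z : singularHomology ℤ ℤ ↥(U ∩ T) (j + 1), ∃ c₁ c₂ : ℤ, z = c₁ • p + c₂ • m := by
    intro z
    obtain ⟨c₁, c₂, hz⟩ := exists_eq_zsmul_meridianPT_add_zsmul_parallelPT hk hθ u₀ hv₀ hv₁
      ((singularHomology.mapIso ℤ ℤ eI (j + 1)).inv z)
    refine ⟨c₂, c₁, ?_⟩
    have hz' := congrArg (singularHomology.mapIso ℤ ℤ eI (j + 1)).hom hz
    rw [← ModuleCat.comp_apply, Iso.inv_hom_id, ModuleCat.id_apply] at hz'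
    rw [hz', singularHomology.mapIso_hom, map_add, map_zsmul, map_zsmul, ← ModuleCat.comp_apply,
      ← ModuleCat.comp_apply, ← singularHomology.map_comp, ← singularHomology.map_comp]
    exact add_comm _ _
  -- (5) in the handle the parallel dies …
  have hpT : (subsetInclusion (inter_subset_right : U ∩ T ⊆ T)).comp
      (eIc.comp (parallelPT (k := j + 1) hv₀ hv₁)) =
      eTc.comp ((glueMapPT ι (j + 1) (j + 1)).comp (parallelPT (k := j + 1) hv₀ hv₁)) := by
    ext q : 1
    apply Subtype.ext
    change ((tubeInterHomeomorph hA hrel (parallelPT (k := j + 1) hv₀ hv₁ q) : ↥(U ∩ T)) : P) =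
      jB (glueMapPT ι (j + 1) (j + 1) (parallelPT (k := j + 1) hv₀ hv₁ q))
    rw [tubeInterHomeomorph_apply_coe, jA_tubeIncl hrel]
  have hm : a₂ p = 0 := by
    change (singularHomology.map ℤ ℤ (eIc.comp (parallelPT (k := j + 1) hv₀ hv₁)) (j + 1) ≫
      singularHomology.map ℤ ℤ (subsetInclusion inter_subset_right) (j + 1)) θ = 0
    rw [← singularHomology.map_comp, hpT, singularHomology.map_comp,
      map_glueMapPT_comp_parallelPT ι (Nat.succ_ne_zero j) hv₀ hv₁, zero_comp]
    rfl
  -- … and the meridian is a generator of infinite order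
  have hmT : (subsetInclusion (inter_subset_right : U ∩ T ⊆ T)).comp
      (eIc.comp (meridianPT (k := j + 1) (l := j + 1) u₀)) =
      eTc.comp ((glueMapPT ι (j + 1) (j + 1)).comp (meridianPT (k := j + 1) (l := j + 1) u₀)) := by
    ext q : 1
    apply Subtype.ext
    change ((tubeInterHomeomorph hA hrel (meridianPT (k := j + 1) (l := j + 1) u₀ q) :
      ↥(U ∩ T)) : P) = jB (glueMapPT ι (j + 1) (j + 1) (meridianPT (k := j + 1) (l := j + 1) u₀ q))
    rw [tubeInterHomeomorph_apply_coe, jA_tubeIncl hrel]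
  haveI hslice := isIso_map_glueMapPT_comp_meridianPT (k := j + 1) ι u₀ (j + 1)
  have ha₂m : a₂ m = (singularHomology.map ℤ ℤ
      ((glueMapPT ι (j + 1) (j + 1)).comp (meridianPT (k := j + 1) (l := j + 1) u₀)) (j + 1) ≫
        singularHomology.map ℤ ℤ eTc (j + 1)) θ := by
    change (singularHomology.map ℤ ℤ (eIc.comp (meridianPT (k := j + 1) (l := j + 1) u₀)) (j + 1) ≫
      singularHomology.map ℤ ℤ (subsetInclusion inter_subset_right) (j + 1)) θ = _
    rw [← singularHomology.map_comp, hmT, singularHomology.map_comp]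
  have hbij : Function.Bijective (singularHomology.map ℤ ℤ
      ((glueMapPT ι (j + 1) (j + 1)).comp (meridianPT (k := j + 1) (l := j + 1) u₀)) (j + 1) ≫
        singularHomology.map ℤ ℤ eTc (j + 1)) := by
    have h2 : singularHomology.map ℤ ℤ eTc (j + 1) = (singularHomology.mapIso ℤ ℤ eT (j + 1)).hom := rfl
    rw [h2]
    exact ConcreteCategory.bijective_of_isIso _
  have hW : ∀ y, ∃ c : ℤ, y = c • a₂ m := by
    intro y
    obtain ⟨x, rfl⟩ := hbij.2 y
    obtain ⟨c, rfl⟩ := mem_zmultiples_iff.1 (hθ.symm ▸ mem_top x : x ∈ zmultiples θ)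
    exact ⟨c, by rw [ha₂m, map_zsmul]⟩
  have hp : ∀ c : ℤ, c • a₂ m = 0 → c = 0 := by
    intro c hc
    rw [ha₂m, ← map_zsmul] at hc
    have h0 : c • θ = 0 := hbij.1 (hc.trans (map_zero _).symm)
    exact eq_zero_of_zsmul_generator_eq_zero (by omega) hθ h0
  -- (6) the diagram chase: `u` is onto with kernel `(a₁ p)ℤ`
  obtain ⟨hs, hker⟩ :=
    Literature.GroupTheory.FiniteAbelian.surjective_and_ker_eq_zmultiples_of_mayerVietoris
      a₁ a₂ u w hcomp hsurj hexact hgen hm hW hp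
  -- (7) transport from `range jA` to `X ∖ S` along `eA`: `jA = val ∘ eA`, `a₁ p = eA_* (parallel)`
  have heA : (subsetIncl U).comp eAc = ⟨jA, hA.continuous⟩ := by ext a; rfl
  have hpU : (subsetInclusion (inter_subset_left : U ∩ T ⊆ U)).comp
      (eIc.comp (parallelPT (k := j + 1) hv₀ hv₁)) = eAc.comp (ν.parallelSphere hv₀) := by
    ext q : 1
    rfl
  have ha₁p : a₁ p = singularHomology.map ℤ ℤ eAc (j + 1)
      (singularHomology.map ℤ ℤ (ν.parallelSphere hv₀) (j + 1) θ) := by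
    change (singularHomology.map ℤ ℤ (eIc.comp (parallelPT (k := j + 1) hv₀ hv₁)) (j + 1) ≫
      singularHomology.map ℤ ℤ (subsetInclusion inter_subset_left) (j + 1)) θ = _
    rw [← singularHomology.map_comp, hpU, singularHomology.map_comp, ModuleCat.comp_apply]
  have hEbij : Function.Bijective (singularHomology.map ℤ ℤ eAc (j + 1)) :=
    ConcreteCategory.bijective_of_isIso (singularHomology.mapIso ℤ ℤ eA (j + 1)).hom
  have hfac : ∀ g, singularHomology.map ℤ ℤ (⟨jA, hA.continuous⟩ : C(_, P)) (j + 1) g =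
      u (singularHomology.map ℤ ℤ eAc (j + 1) g) := by
    intro g
    change _ = (singularHomology.map ℤ ℤ eAc (j + 1) ≫ singularHomology.map ℤ ℤ (subsetIncl U) (j + 1)) g
    rw [← singularHomology.map_comp, heA]
  refine ⟨fun y => ?_, ?_⟩
  · obtain ⟨x, rfl⟩ := hs y
    obtain ⟨g, rfl⟩ := hEbij.2 x
    exact ⟨g, hfac g⟩
  · ext g
    rw [AddMonoidHom.mem_ker, mem_zmultiples_iff]
    change singularHomology.map ℤ ℤ (⟨jA, hA.continuous⟩ : C(_, P)) (j + 1) g = 0 ↔ _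
    rw [hfac]
    change singularHomology.map ℤ ℤ eAc (j + 1) g ∈ u.ker ↔ _
    rw [hker, mem_zmultiples_iff, ha₁p]
    constructor
    · rintro ⟨c, hc⟩
      exact ⟨c, hEbij.1 (by rw [map_zsmul]; exact hc)⟩
    · rintro ⟨c, rfl⟩
      exact ⟨c, by rw [map_zsmul]⟩

end HandleKernel

/-! ### The converse duality sentence, and a class of infinite order in `Hₗ₊₁(W | S)` -/

section Duality

open ExtCollar

variable {n k l : ℕ} {W : Type} [TopologicalSpace W] [ChartedSpace (EuclideanHalfSpace (n + 1)) W]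
  (ν : FramedSphereFamily (𝓡∂ (n + 1)) W Unit k (l + 1))

/-- **The converse duality sentence: a torsion sphere class has `μ·λ = 0` for every `μ`.** For a
framed sphere `ν : Sᵏ × ℝˡ⁺¹ ↪ W` (`k + l = n`, `k ≥ 2`) in a compact simply connected smooth
`(n+1)`-manifold with boundary `W` and a generator `θ` of `Hₖ(Sᵏ; ℤ)`: if every homomorphism
`f : Hₖ(W; ℤ) → ℤ` kills `λ = (ν.sphereMap)⁎ θ` (equivalently, `λ` is a torsion class of the
finitely generated group `HₖW`), then `j⁎ : Hₗ₊₁(W; ℤ) → Hₗ₊₁(W, W ∖ S; ℤ)` is ZERO — the map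
`μ ↦ μ·λ` of Kervaire–Milnor's diagram (1963, p. 515: "the homomorphism `Hₖ₊₁M → Z` can be
described as the homomorphism `μ → μ·λ`"; p. 516) vanishes identically. Same computation as
`exists_ofAbsolute_eq_zsmul_of_exists_dual`: `μ ↦ μ₁ = α ⌢ z ∈ Hₗ₊₁(M, bM)` (Lefschetz
duality), whose image in `Hₗ₊₁(M | S)` read in the external collar is `α|_S ⌢ [X]_S`, and
`α|_S ∈ Ȟᵏ(S) ≅ ℤ` is detected by `⟨α|_S, [S]⟩ = ⟨α, λ⟩ = 0`.
[cite: KervaireMilnorAnnals1963, Lemma 5.6 (p. 515) and Lemma 5.7, proof (p. 516)] [cite: Miller2020, Thm. 37.1] -/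
theorem ofAbsolute_complement_apply_eq_zero_of_forall_dual_eq_zero [T2Space W] [CompactSpace W]
    [IsManifold (𝓡∂ (n + 1)) ∞ W] [SimplyConnectedSpace W] (hkl : k + l = n) (hk : 2 ≤ k)
    {θ : singularHomology ℤ ℤ (Metric.sphere (0 : EuclideanSpace ℝ (Fin (k + 1))) 1) k}
    (hθ : zmultiples θ = ⊤)
    (hlam : ∀ f : singularHomology ℤ ℤ W k →+ ℤ, f (singularHomology.map ℤ ℤ ν.sphereMap k θ) = 0)
    (x : singularHomology ℤ ℤ W (l + 1)) :
    relativeSingularHomology.ofAbsolute ℤ ℤ W (ν.complement : Set W) (l + 1) x = 0 := by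
  have hdeg : k + (l + 1) = n + 1 := by omega
  have hS'c : IsCompact (incl n '' ν.cores : Set (ExtCollar n W)) :=
    ν.isCompact_cores.image continuous_incl
  -- (1) the relative fundamental class and Lefschetz duality: `x ↦ x₁ = α ⌢ z`
  obtain ⟨z, hz⟩ := exists_isRelFundamentalClass_of_simplyConnectedSpace n W
  set x₁ := relativeSingularHomology.ofAbsolute ℤ ℤ W ((𝓡∂ (n + 1)).boundary W) (l + 1) x
    with hx₁
  obtain ⟨α, hα⟩ := (bijective_relCapProduct_of_isRelFundamentalClass_holds (R := ℤ) n W z hz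
    hdeg).2 x₁
  -- (2) `⟨α, λ⟩ = 0`
  have hαθ : kroneckerPairing ℤ ℤ W k α (singularHomology.map ℤ ℤ ν.sphereMap k θ) = 0 :=
    hlam (kroneckerPairing ℤ ℤ W k α).toAddMonoidHom
  -- (3) the pieces of the diagram
  set jS := relativeSingularHomology.map ℤ ℤ (ContinuousMap.id W)
    (ν.mapsTo_id_boundary_compl_cores hkl) (l + 1) with hjS
  set E := relativeSingularHomology.map ℤ ℤ (inclCM n) ν.mapsTo_incl_compl_cores (l + 1) with hE
  haveI : IsIso E := ν.isIso_map_incl_compl_cores hkl (l + 1)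
  set cI := relativeSingularHomology.concreteIso ℤ ℤ (ExtCollar n W) (incl n '' ν.cores)ᶜ (l + 1)
    with hcI
  obtain ⟨T⟩ := ν.nonempty_retractionNhds_image_cores hkl
  obtain ⟨e, he⟩ := ν.exists_homeomorph_sphere_image_cores (n := n)
  -- the Čech class of `α` over the core vanishes
  set aS : Cech ℤ (ModuleCat.of ℤ (ULift.{0} ℤ)) (incl n '' ν.cores : Set (ExtCollar n W)) k :=
    Cech.of ℤ (SimplexSpan.coefR ℤ) (OpenNhd.univ (incl n '' ν.cores))
      (subsetCochains.thetaInv k (singularCohomology.map ℤ ℤ baseCM k α)) with haS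
  let L : Cech ℤ (ModuleCat.of ℤ (ULift.{0} ℤ)) (incl n '' ν.cores : Set (ExtCollar n W)) k → ℤ :=
    fun b => kroneckerPairing ℤ ℤ (Metric.sphere (0 : EuclideanSpace ℝ (Fin (k + 1))) 1) k
      (singularCohomology.map ℤ ℤ
        (e : C(Metric.sphere (0 : EuclideanSpace ℝ (Fin (k + 1))) 1, ↥(incl n '' ν.cores))) k
        (Cech.toSingularCohomology ℤ (incl n '' ν.cores) k b)) θ
  have hL : ∀ b, L b = kroneckerPairing ℤ ℤ (Metric.sphere (0 : EuclideanSpace ℝ (Fin (k + 1))) 1) k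
      (singularCohomology.map ℤ ℤ
        (e : C(Metric.sphere (0 : EuclideanSpace ℝ (Fin (k + 1))) 1, ↥(incl n '' ν.cores))) k
        (Cech.toSingularCohomology ℤ (incl n '' ν.cores) k b)) θ := fun b => rfl
  have haL : L aS = 0 := by
    rw [hL, haS, FramedSphereFamily.kroneckerPairing_cechClass_eq ν e he α θ]; exact hαθ
  have haS0 : aS = 0 := Literature.Topology.FourManifolds.Cech.eq_zero_of_sphere T hk e hθ L hL haL
  -- hence `E (jS (α ⌢ z)) = 0`
  have hμ : cI.hom (E (jS (relCapProduct (M := ℤ) ((𝓡∂ (n + 1)).boundary W) hdeg α z))) =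
      cechCap hS'c.isClosed hdeg
        (HomologicalOrientation.classAlong (Nat.le_add_left 1 n) (ExtCollar.orientation z hz) hS'c)
        aS :=
    ν.concreteIso_map_incl_relCapProduct hkl hdeg z hz α
  rw [haS0, map_zero] at hμ
  have h1 : E (jS x₁) = 0 := by
    apply ((forget (ModuleCat ℤ)).mapIso cI).toEquiv.injective
    change cI.hom (E (jS x₁)) = cI.hom 0
    rw [map_zero, ← hα]
    exact hμ
  have h2 : jS x₁ = 0 :=
    (ModuleCat.mono_iff_injective E).1 inferInstance (by rw [h1, map_zero])
  -- and `j x = jS x₁`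
  change (relativeSingularHomology.ofAbsolute ℤ ℤ W ν.coresᶜ (l + 1)) x = 0
  have h3 : (relativeSingularHomology.ofAbsolute ℤ ℤ W ν.coresᶜ (l + 1)) x = jS x₁ := by
    change _ = (relativeSingularHomology.ofAbsolute ℤ ℤ W ((𝓡∂ (n + 1)).boundary W) (l + 1) ≫ jS) x
    rw [hjS, relativeSingularHomology.ofAbsolute_comp_map, singularHomology.map_id]
    rfl
  rw [h3, h2]

/-- **`Hₗ₊₁(W, W ∖ S; ℤ)` has a class of infinite order** (indeed it is `≅ Ȟᵏ(S) ≅ Hᵏ(Sᵏ) ≅ ℤ`):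
Čech–Poincaré duality along the compact core `S ≅ Sᵏ` in the external collar
(`HomologicalOrientation.bijective_cechCap_classAlong`, Miller Thm. 37.1) is injective on a
Čech class pairing non-trivially with `[S]`, which exists because `Ȟᵏ(S) → Hᵏ(S) ≅ Hᵏ(Sᵏ)`
is onto (tautness) and `Hᵏ(Sᵏ; ℤ) → Hom(Hₖ(Sᵏ), ℤ)` is onto (universal coefficients).
(Kervaire–Milnor 1963, p. 515: "`Hₖ₊₁(M, M₀) ≅ Hₖ₊₁(Sᵏ × Dᵏ⁺¹, Sᵏ × Sᵏ) ≅ Z`".)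
[cite: KervaireMilnorAnnals1963, Lemma 5.6, proof (p. 515)] [cite: Miller2020, Thm. 37.1] -/
theorem exists_forall_zsmul_eq_zero_imp_relativeHomology_complement [T2Space W] [CompactSpace W]
    [IsManifold (𝓡∂ (n + 1)) ∞ W] [SimplyConnectedSpace W] (hkl : k + l = n) (hk : 2 ≤ k)
    {θ : singularHomology ℤ ℤ (Metric.sphere (0 : EuclideanSpace ℝ (Fin (k + 1))) 1) k}
    (hθ : zmultiples θ = ⊤) :
    ∃ g : relativeSingularHomology ℤ ℤ W (ν.complement : Set W) (l + 1),
      ∀ m : ℤ, m • g = 0 → m = 0 := by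
  have hdeg : k + (l + 1) = n + 1 := by omega
  have hS'c : IsCompact (incl n '' ν.cores : Set (ExtCollar n W)) :=
    ν.isCompact_cores.image continuous_incl
  obtain ⟨z, hz⟩ := exists_isRelFundamentalClass_of_simplyConnectedSpace n W
  set E := relativeSingularHomology.map ℤ ℤ (inclCM n) ν.mapsTo_incl_compl_cores (l + 1) with hE
  haveI : IsIso E := ν.isIso_map_incl_compl_cores hkl (l + 1)
  set cI := relativeSingularHomology.concreteIso ℤ ℤ (ExtCollar n W) (incl n '' ν.cores)ᶜ (l + 1)
    with hcI
  obtain ⟨T⟩ := ν.nonempty_retractionNhds_image_cores hkl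
  obtain ⟨e, he⟩ := ν.exists_homeomorph_sphere_image_cores (n := n)
  let L : Cech ℤ (ModuleCat.of ℤ (ULift.{0} ℤ)) (incl n '' ν.cores : Set (ExtCollar n W)) k → ℤ :=
    fun b => kroneckerPairing ℤ ℤ (Metric.sphere (0 : EuclideanSpace ℝ (Fin (k + 1))) 1) k
      (singularCohomology.map ℤ ℤ
        (e : C(Metric.sphere (0 : EuclideanSpace ℝ (Fin (k + 1))) 1, ↥(incl n '' ν.cores))) k
        (Cech.toSingularCohomology ℤ (incl n '' ν.cores) k b)) θ
  have hLadd : ∀ (m : ℤ) b, L (m • b) = m * L b := by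
    intro m b
    change kroneckerPairing ℤ ℤ _ k (singularCohomology.map ℤ ℤ _ k
      (Cech.toSingularCohomology ℤ (incl n '' ν.cores) k (m • b))) θ = _
    rw [map_zsmul, map_zsmul, map_zsmul, LinearMap.smul_apply, smul_eq_mul]
  -- (1) a class `σ ∈ Hᵏ(Sᵏ)` with `⟨σ, θ⟩ ≠ 0`
  obtain ⟨esph⟩ := nonempty_singularHomology_sphere_iso_holds ℤ ℤ (n := k) (by omega)
  have hθ0 : θ ≠ 0 := by
    intro h0
    have htop : (⊤ : AddSubgroup (singularHomology ℤ ℤ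
        (Metric.sphere (0 : EuclideanSpace ℝ (Fin (k + 1))) 1) k)) = ⊥ := by
      rw [← hθ, h0, zmultiples_zero_eq_bot]
    have hall : ∀ y : singularHomology ℤ ℤ (Metric.sphere (0 : EuclideanSpace ℝ (Fin (k + 1))) 1) k,
        y = 0 := fun y => (AddSubgroup.eq_bot_iff_forall _).1 htop y (mem_top y)
    have h1 : esph.inv (ULift.up (1 : ℤ)) = 0 := hall _
    have h2 := congrArg esph.hom h1
    rw [← ModuleCat.comp_apply, Iso.inv_hom_id, ModuleCat.id_apply, map_zero] at h2
    exact one_ne_zero (congrArg ULift.down h2)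
  let fL : singularHomology ℤ ℤ (Metric.sphere (0 : EuclideanSpace ℝ (Fin (k + 1))) 1) k →ₗ[ℤ] ℤ :=
    ULift.moduleEquiv.toLinearMap ∘ₗ esph.hom.hom
  have hfL : fL θ ≠ 0 := by
    intro h0
    apply hθ0
    have h1 : esph.hom θ = 0 := by
      apply ULift.ext
      exact h0
    have h2 := congrArg esph.inv h1
    rwa [← ModuleCat.comp_apply, Iso.hom_inv_id, ModuleCat.id_apply, map_zero] at h2
  obtain ⟨σ, hσ⟩ := kroneckerPairing_surjective ℤ
    (Metric.sphere (0 : EuclideanSpace ℝ (Fin (k + 1))) 1) k fL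
  -- (2) a Čech class `c` of the core with `L c = ⟨σ, θ⟩ ≠ 0`
  let eIso := singularCohomology.mapIso ℤ ℤ e k
  obtain ⟨c, hc⟩ := (T.bijective_toSingularCohomology (R := ℤ) k).2 (eIso.inv σ)
  have hLc : L c ≠ 0 := by
    change kroneckerPairing ℤ ℤ _ k (singularCohomology.map ℤ ℤ _ k
      (Cech.toSingularCohomology ℤ (incl n '' ν.cores) k c)) θ ≠ 0
    rw [hc]
    change kroneckerPairing ℤ ℤ _ k ((eIso.inv ≫ eIso.hom) σ) θ ≠ 0
    rw [Iso.inv_hom_id, ModuleCat.id_apply, hσ]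
    exact hfL
  -- (3) its Čech cap product with `[X]_S` has infinite order, and so has its transport to `W`
  set y := cechCap hS'c.isClosed hdeg
    (HomologicalOrientation.classAlong (Nat.le_add_left 1 n) (ExtCollar.orientation z hz) hS'c) c
    with hy
  have hinj := (HomologicalOrientation.bijective_cechCap_classAlong (Nat.le_add_left 1 n)
    (ExtCollar.orientation z hz) hS'c hdeg).1
  have hy0 : ∀ m : ℤ, m • y = 0 → m = 0 := by
    intro m hm
    rw [hy, ← map_zsmul] at hm
    have hmc : m • c = 0 := hinj (hm.trans (map_zero _).symm)
    have := hLadd m c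
    rw [hmc] at this
    have hL0 : L 0 = 0 := by
      change kroneckerPairing ℤ ℤ _ k (singularCohomology.map ℤ ℤ _ k
        (Cech.toSingularCohomology ℤ (incl n '' ν.cores) k 0)) θ = 0
      rw [map_zero, map_zero, map_zero, LinearMap.zero_apply]
    rw [hL0] at this
    rcases mul_eq_zero.1 this.symm with h | h
    · exact h
    · exact absurd h hLc
  -- transport: `g = E⁻¹ (cI⁻¹ y)`
  set g : relativeSingularHomology ℤ ℤ W ν.coresᶜ (l + 1) := inv E (cI.inv y) with hg
  have hEg : cI.hom (E g) = y := by
    have h1 : E g = cI.inv y := by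
      rw [hg, ← ModuleCat.comp_apply, IsIso.inv_hom_id, ModuleCat.id_apply]
    rw [h1, ← ModuleCat.comp_apply, Iso.inv_hom_id, ModuleCat.id_apply]
  have hg0 : ∀ m : ℤ, m • g = 0 → m = 0 := by
    intro m hm
    apply hy0 m
    have h1 : cI.hom (E (m • g)) = cI.hom (E 0) := by rw [hm]
    rwa [map_zsmul, map_zsmul, hEg, map_zero, map_zero] at h1
  exact ⟨g, hg0⟩

end Duality

/-! ### Exactly one of `ε`, `ε'` is torsion, from the isotropy of the torus -/

section Xor

open ExtCollar

variable {n k : ℕ} {W : Type} [TopologicalSpace W] [ChartedSpace (EuclideanHalfSpace (n + 1)) W]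
  [T2Space W] [CompactSpace W] [IsManifold (𝓡∂ (n + 1)) ∞ W] [SimplyConnectedSpace W]
  (ν : FramedSphereFamily (𝓡∂ (n + 1)) W Unit k (k + 1))

/-- **In odd middle dimension, exactly one of the parallel and the meridian classes is torsion in
`Hₖ(W ∖ S)` — from the isotropy of the torus.** Let `W` be a compact simply connected smooth
`(2k+1)`-manifold with boundary (`k ≥ 2`) with `Hₖ(∂W; ℤ) = 0`, `ν : Sᵏ × ℝᵏ⁺¹ ↪ W` a framed
sphere with core `S`, `θ` a generator of `Hₖ(Sᵏ; ℤ)`, `ε = (parallel)_* θ`, `ε' = (meridian)_* θ`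
in `G = Hₖ(W ∖ S; ℤ)`, and assume the isotropy `(ISO)`: `m • ε = n • ε' → m * n = 0`. Then `ε`
is torsion iff `ε'` is not. Proof (Kervaire–Milnor 1963, pp. 515–519, reorganised): with
`λ = i ε ∈ HₖW`, `ker i = ε'(Z) = im ∂` (`SphereCoreMeridian`), `im j = ker ∂`:
* if `ε'` has infinite order then `λ` is torsion (else some `f : HₖW → ℤ` has `f λ = d ≠ 0`, and
  `d • (W | S) ⊆ im j = ker ∂` — `exists_ofAbsolute_eq_zsmul_of_exists_dual` — gives `d ε' = 0`),
  so `m λ = 0`, `m ε ∈ ε'(Z)`, `m ε = n ε'`, and `(ISO)` forces `n = 0`: `ε` is torsion;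
* if `ε'` and `ε` were both torsion then `λ` is torsion, `j = 0`
  (`ofAbsolute_complement_apply_eq_zero_of_forall_dual_eq_zero`), `∂` is injective with finite
  image `ε'(Z)`, contradicting the class of infinite order of `Hₖ₊₁(W | S)`.
[cite: KervaireMilnorAnnals1963, Lemmas 5.6–5.8 (pp. 515–518) and p. 519] [cite: Thom1952, Thm. V.10 (p. 176)] -/
theorem isOfFinAddOrder_parallel_iff_not_meridian_of_iso (hkl : k + k = n) (hk : 2 ≤ k)
    (hbd : IsZero (singularHomology ℤ ℤ ↥((𝓡∂ (n + 1)).boundary W) k))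
    {θ : singularHomology ℤ ℤ (Metric.sphere (0 : EuclideanSpace ℝ (Fin (k + 1))) 1) k}
    (hθ : zmultiples θ = ⊤) (u₀ : Metric.sphere (0 : EuclideanSpace ℝ (Fin (k + 1))) 1)
    {v₀ : EuclideanSpace ℝ (Fin (k + 1))} (hv₀ : v₀ ≠ 0)
    (hiso : ∀ m m' : ℤ, m • singularHomology.map ℤ ℤ (ν.parallelSphere hv₀) k θ =
      m' • singularHomology.map ℤ ℤ (ν.tubeIncl.comp (meridianPT u₀)) k θ → m * m' = 0) :
    IsOfFinAddOrder (singularHomology.map ℤ ℤ (ν.parallelSphere hv₀) k θ) ↔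
      ¬IsOfFinAddOrder (singularHomology.map ℤ ℤ (ν.tubeIncl.comp (meridianPT u₀)) k θ) := by
  set a := singularHomology.map ℤ ℤ (ν.parallelSphere hv₀) k θ with ha
  set b := singularHomology.map ℤ ℤ (ν.tubeIncl.comp (meridianPT u₀)) k θ with hb
  -- the maps of the exact sequence of the pair `(W, W ∖ S)`
  let iX := singularHomology.map ℤ ℤ (subsetIncl (ν.complement : Set W)) k
  let jW := relativeSingularHomology.ofAbsolute ℤ ℤ W (ν.complement : Set W) (k + 1)
  let dW := relativeSingularHomology.δ ℤ ℤ W (ν.complement : Set W) k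
  have hlam : iX a = singularHomology.map ℤ ℤ ν.sphereMap k θ := by
    change (singularHomology.map ℤ ℤ (ν.parallelSphere hv₀) k ≫ iX) θ = _
    rw [← singularHomology.map_comp, map_parallelSphere_eq_map_sphere ℤ ℤ hv₀ k]
  -- `ker i = ε'(Z)` (horizontal sequence of Lemma 5.6)
  have hker : iX.hom.toAddMonoidHom.ker = zmultiples b :=
    (ν.surjective_map_complement_and_ker_eq hk hθ u₀).2
  have hiXb : iX b = 0 := by
    have : b ∈ iX.hom.toAddMonoidHom.ker := by rw [hker]; exact mem_zmultiples b
    exact this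
  -- exactness: `im ∂ = ker i`, `im j = ker ∂`, `∂ ∘ j = 0`
  have hex₁ := (ShortComplex.moduleCat_exact_iff _).1
    (relativeSingularHomology.exact_δ_map ℤ ℤ (ν.complement : Set W) k)
  have hex₂ := (ShortComplex.moduleCat_exact_iff _).1
    (relativeSingularHomology.exact_ofAbsolute_δ ℤ ℤ (ν.complement : Set W) k)
  have hdj : ∀ x, dW (jW x) = 0 := fun x => by
    change (jW ≫ dW) x = 0
    rw [relativeSingularHomology.ofAbsolute_comp_δ]
    rfl
  obtain ⟨g₀, hg₀⟩ : ∃ g₀, dW g₀ = b := hex₁ b hiXb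
  -- `HₖW` is finitely generated
  haveI : AddGroup.FG (singularHomology ℤ ℤ W k) := by
    have h := finite_singularHomology_of_compact_chartedSpace_halfSpace ℤ ℤ (n := n) (W := W) k
    exact Module.Finite.iff_addGroup_fg.1
      (by convert h using 2 <;> first | rfl | exact Subsingleton.elim _ _)
  constructor
  · -- both torsion is impossible
    intro hafin hbfin
    -- `λ` is torsion, so `j = 0`
    have hlamfin : IsOfFinAddOrder (singularHomology.map ℤ ℤ ν.sphereMap k θ) := by
      rw [← hlam]; exact iX.hom.toAddMonoidHom.isOfFinAddOrder hafin
    have hj0 : ∀ x, jW x = 0 := fun x =>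
      ν.ofAbsolute_complement_apply_eq_zero_of_forall_dual_eq_zero hkl hk hθ
        (fun f => Literature.GroupTheory.FiniteAbelian.addMonoidHom_apply_eq_zero_of_isOfFinAddOrder
          hlamfin f) x
    -- `∂` is injective
    have hdinj : ∀ y, dW y = 0 → y = 0 := by
      intro y hy
      obtain ⟨x, rfl⟩ := hex₂ y hy
      exact hj0 x
    -- a class `g` of infinite order in `Hₖ₊₁(W | S)`; `∂ g ∈ ker i = ε'(Z)` and `r ε' = 0`
    obtain ⟨g, hg⟩ := ν.exists_forall_zsmul_eq_zero_imp_relativeHomology_complement hkl hk hθ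
    obtain ⟨r, hr, hrb⟩ := (isOfFinAddOrder_iff_nsmul_eq_zero).1 hbfin
    have hdg : dW g ∈ zmultiples b := by
      rw [← hker]
      change iX (dW g) = 0
      change (dW ≫ iX) g = 0
      rw [relativeSingularHomology.δ_comp_map]
      rfl
    obtain ⟨s, hs⟩ := mem_zmultiples_iff.1 hdg
    have h0 : (r : ℤ) • g = 0 := by
      apply hdinj
      rw [map_zsmul, ← hs, smul_smul, mul_comm, ← smul_smul, natCast_zsmul, hrb, zsmul_zero]
    have := hg r h0
    omega
  · -- `ε'` of infinite order forces `ε` torsion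
    intro hbinf
    -- `λ` is torsion
    have hlamfin : IsOfFinAddOrder (singularHomology.map ℤ ℤ ν.sphereMap k θ) := by
      apply Literature.GroupTheory.FiniteAbelian.isOfFinAddOrder_of_forall_addMonoidHom_eq_zero
      intro f
      by_contra hf
      obtain ⟨x, hx⟩ := ν.exists_ofAbsolute_eq_zsmul_of_exists_dual hkl hk hbd hθ
        (d := f (singularHomology.map ℤ ℤ ν.sphereMap k θ)) ⟨f, rfl⟩ g₀
      have h1 : f (singularHomology.map ℤ ℤ ν.sphereMap k θ) • b = 0 := by
        rw [← hg₀, ← map_zsmul, ← hx]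
        exact hdj x
      exact hbinf ((isOfFinAddOrder_iff_zsmul_eq_zero).2 ⟨_, hf, h1⟩)
    obtain ⟨m, hm, hmlam⟩ := (isOfFinAddOrder_iff_nsmul_eq_zero).1 hlamfin
    -- `m ε ∈ ker i = ε'(Z)`
    have hma : (m : ℤ) • a ∈ zmultiples b := by
      rw [← hker]
      change iX ((m : ℤ) • a) = 0
      rw [map_zsmul, hlam, natCast_zsmul, hmlam]
    obtain ⟨m', hm'⟩ := mem_zmultiples_iff.1 hma
    have hmm' := hiso m m' hm'.symm
    have hm'0 : m' = 0 := by
      rcases Int.mul_eq_zero.1 hmm' with h | h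
      · exact absurd h (by exact_mod_cast hm.ne')
      · exact h
    rw [hm'0, zero_zsmul] at hm'
    exact (isOfFinAddOrder_iff_nsmul_eq_zero).2 ⟨m, hm, by rw [← natCast_zsmul]; exact hm'.symm⟩

end Xor

/-! ### Lemma 5.8 from the isotropy of the torus -/

section Lemma58

variable {n k : ℕ} {W : Type} [TopologicalSpace W] [ChartedSpace (EuclideanHalfSpace (n + 1)) W]
  [T2Space W] [CompactSpace W] [IsManifold (𝓡∂ (n + 1)) ∞ W] [SimplyConnectedSpace W]
  (ν : FramedSphereFamily (𝓡∂ (n + 1)) W Unit k (k + 1))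

/-- **Kervaire–Milnor's Lemma 5.8 from the isotropy of the torus.** In the setting of
`isOfFinAddOrder_parallel_iff_not_meridian_of_iso` (a compact simply connected smooth
`(2k+1)`-manifold with boundary, `k ≥ 2`, `Hₖ(∂W; ℤ) = 0`, a framed `k`-sphere `φ` and the
isotropy `(ISO)` of its torus), *"the modification `χ(φ)` necessarily changes the `k`-th Betti
number"*: `rank Hₖ(χ(W, φ); ℤ) ≠ rank Hₖ(W; ℤ)`. Proof: `HₖW ≅ G/ε'(Z)` and `Hₖχ ≅ G/ε(Z)` for
`G = Hₖ(W ∖ S)` (the two exact sequences of Lemma 5.6, `surjective_map_complement_and_ker_eq`,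
`surjective_map_jA_and_ker_eq`), `rank (G/x(Z)) = rank G - [x of infinite order]`, and exactly
one of `ε`, `ε'` is torsion. [cite: KervaireMilnorAnnals1963, Lemma 5.8 (p. 516)] -/
theorem finrank_surgered_ne_of_iso (hkl : k + k = n) (hk : 2 ≤ k)
    (hbd : IsZero (singularHomology ℤ ℤ ↥((𝓡∂ (n + 1)).boundary W) k))
    {θ : singularHomology ℤ ℤ (Metric.sphere (0 : EuclideanSpace ℝ (Fin (k + 1))) 1) k}
    (hθ : zmultiples θ = ⊤) (u₀ : Metric.sphere (0 : EuclideanSpace ℝ (Fin (k + 1))) 1)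
    {v₀ : EuclideanSpace ℝ (Fin (k + 1))} (hv₀ : v₀ ≠ 0) (hv₁ : ‖v₀‖ < 1)
    (hiso : ∀ m m' : ℤ, m • singularHomology.map ℤ ℤ (ν.parallelSphere hv₀) k θ =
      m' • singularHomology.map ℤ ℤ (ν.tubeIncl.comp (meridianPT u₀)) k θ → m * m' = 0) :
    Module.finrank ℤ (singularHomology ℤ ℤ (ν.Surgered hkl) k) ≠
      Module.finrank ℤ (singularHomology ℤ ℤ W k) := by
  set G := singularHomology ℤ ℤ ↥ν.complement k
  set a : G := singularHomology.map ℤ ℤ (ν.parallelSphere hv₀) k θ with ha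
  set b : G := singularHomology.map ℤ ℤ (ν.tubeIncl.comp (meridianPT u₀)) k θ with hb
  -- `HₖW ≅ G/ε'(Z)`
  let iX := (singularHomology.map ℤ ℤ (subsetIncl (ν.complement : Set W)) k).hom.toAddMonoidHom
  obtain ⟨hsX, hkerX⟩ := ν.surjective_map_complement_and_ker_eq hk hθ u₀
  have eX : G ⧸ zmultiples b ≃+ singularHomology ℤ ℤ W k :=
    (QuotientAddGroup.quotientAddEquivOfEq hkerX.symm).trans
      (QuotientAddGroup.quotientKerEquivOfSurjective iX hsX)
  -- `Hₖχ ≅ G/ε(Z)`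
  obtain ⟨hA, hB, hcov, hrel⟩ := ν.surgered_gluing hkl
  let iP := (singularHomology.map ℤ ℤ (⟨(ν.glueData hkl).inl, hA.continuous⟩ :
    C(↥ν.complement, ν.Surgered hkl)) k).hom.toAddMonoidHom
  obtain ⟨hsP, hkerP⟩ := surjective_map_jA_and_ker_eq hA hB hcov hrel hk hθ hv₀ hv₁
  have eP : G ⧸ zmultiples a ≃+ singularHomology ℤ ℤ (ν.Surgered hkl) k :=
    (QuotientAddGroup.quotientAddEquivOfEq hkerP.symm).trans
      (QuotientAddGroup.quotientKerEquivOfSurjective iP hsP)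
  -- `G` is finitely generated: extension of `HₖW` by `ε'(Z)` (in the `ℤ`-module structures of the
  -- bundled homology groups; all `ℤ`-module structures of an abelian group agree)
  haveI : Module.Finite ℤ (singularHomology ℤ ℤ W k) :=
    finite_singularHomology_of_compact_chartedSpace_halfSpace ℤ ℤ (n := n) (W := W) k
  have hGfin : Module.Finite ℤ G := by
    rw [Module.finite_def]
    let F := (singularHomology.map ℤ ℤ (subsetIncl (ν.complement : Set W)) k).hom
    refine Submodule.fg_of_fg_map_of_fg_inf_ker F ?_ ?_
    · exact IsNoetherian.noetherian _
    · rw [top_inf_eq]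
      have hbker : F b = 0 := by
        have : b ∈ iX.ker := by rw [hkerX]; exact mem_zmultiples b
        exact this
      have hk' : LinearMap.ker F = Submodule.span ℤ {b} := by
        apply le_antisymm
        · intro x hx
          have hx' : x ∈ iX.ker := hx
          rw [hkerX] at hx'
          obtain ⟨m, rfl⟩ := mem_zmultiples_iff.1 hx'
          exact Submodule.mem_span_singleton.2 ⟨m, int_smul_eq_zsmul _ m b⟩
        · rw [Submodule.span_le, Set.singleton_subset_iff]
          exact hbker
      rw [hk']
      exact Submodule.fg_span (Set.finite_singleton b)
  haveI : AddGroup.FG G := Module.Finite.iff_addGroup_fg.1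
    (by convert hGfin using 2; exact Subsingleton.elim _ _)
  -- ranks
  have hxor := ν.isOfFinAddOrder_parallel_iff_not_meridian_of_iso hkl hk hbd hθ u₀ hv₀ hiso
  have key : Module.finrank ℤ (G ⧸ zmultiples a) ≠ Module.finrank ℤ (G ⧸ zmultiples b) := by
    rw [Ne, finrank_quotient_zmultiples_eq_iff a b]
    tauto
  rw [eP.toIntLinearEquiv.finrank_eq, eX.toIntLinearEquiv.finrank_eq] at key
  exact key

end Lemma58

end FramedSphereFamily

/-! ### Kervaire–Milnor's setting: null-cobordisms of homotopy spheres -/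

/-- **Lemma 5.8 from the isotropy of the torus, for a null-cobordism of a homotopy sphere**
(Kervaire–Milnor 1963, Hypothesis p. 516: `M` compact, simply connected, `bM` a homotopy sphere;
Lemma 5.8, p. 516): for `W` a simply connected null-cobordism of a homotopy `2k`-sphere (`k ≥ 2`,
so `Hₖ(bW) = Hₖ(S²ᵏ) = 0`), a framed `k`-sphere `ν : Sᵏ × ℝᵏ⁺¹ ↪ W`, a generator `θ` of
`Hₖ(Sᵏ; ℤ)` and the isotropy `(ISO)` of its torus, the modification changes the `k`-th Betti
number: `rank Hₖ(χ(W, φ); ℤ) ≠ rank Hₖ(W; ℤ)`.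
[cite: KervaireMilnorAnnals1963, Lemma 5.8 (p. 516)] [cite: HatcherAT2002, Cor. 2.14] -/
theorem NullCobordism.finrank_surgery_ne_of_iso {n k : ℕ} (S : HomotopySphere n)
    (c : NullCobordism.{0} n S.carrier) [SimplyConnectedSpace c.W]
    (ν : FramedSphereFamily (𝓡∂ (n + 1)) c.W Unit k (k + 1)) (hkl : k + k = n) (hk : 2 ≤ k)
    {θ : singularHomology ℤ ℤ (Metric.sphere (0 : EuclideanSpace ℝ (Fin (k + 1))) 1) k}
    (hθ : zmultiples θ = ⊤) (u₀ : Metric.sphere (0 : EuclideanSpace ℝ (Fin (k + 1))) 1)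
    {v₀ : EuclideanSpace ℝ (Fin (k + 1))} (hv₀ : v₀ ≠ 0) (hv₁ : ‖v₀‖ < 1)
    (hiso : ∀ m m' : ℤ, m • singularHomology.map ℤ ℤ (ν.parallelSphere hv₀) k θ =
      m' • singularHomology.map ℤ ℤ (ν.tubeIncl.comp (FramedSphereFamily.meridianPT u₀)) k θ →
        m * m' = 0) :
    Module.finrank ℤ (singularHomology ℤ ℤ (c.surgery ν hkl).W k) ≠
      Module.finrank ℤ (singularHomology ℤ ℤ c.W k) := by
  -- `∂W ≅ Σ ≃ S²ᵏ`, so `Hₖ(∂W) = 0`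
  let e : ↥((𝓡∂ (n + 1)).boundary c.W) ≃ₜ S.carrier :=
    (c.isSmoothEmbedding_incl.isEmbedding.toHomeomorph.trans (Homeomorph.setCongr c.range_incl)).symm
  have hbd : IsZero (singularHomology ℤ ℤ ↥((𝓡∂ (n + 1)).boundary c.W) k) :=
    (isZero_singularHomology_sphere_holds ℤ ℤ (by omega) (by omega)).of_iso
      (singularHomology.isoOfHomotopyEquiv ℤ ℤ
        (e.toHomotopyEquiv.trans S.nonempty_homotopyEquiv.some) k)
  exact ν.finrank_surgered_ne_of_iso hkl hk hbd hθ u₀ hv₀ hv₁ hiso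

end Literature.Topology.FourManifolds

end
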